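import Summits.HubbardSuperconductivity.HubbardSuperconductivity.Theorems.BalabanIRBirGappedPhaseReductionRChiralityWallCore
import Summits.HubbardSuperconductivity.HubbardSuperconductivity.Theorems.BalabanIRBirBdGPhaseCoercivityLyapunovFinal

/-!
# Route BalabanIR — crux 4R `BirGappedPhaseReductionR` (item `stmt-HubbardSuperconductivity-14846`),
# line `chirality-sheet-peierls`, static input (W): CHIRALITY-WALL COERCIVITY of the `d+id` BdG energy,
# for all parameters and all textures

THEOREM (`bdgChiralityWallCoercivity`, the body of the card's first lemma `BdGChiralityWallCoercivity`
— Sketch §B of ideator 2, Cruxes/BirGappedPhaseReductionR/SketchIdeator2.lean — with `bdgHb` and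
`frustratedDiagonals` unfolded, stated structurally so that this module imports no Cruxes/Theses file).
On the torus `(ℤ/L)²` let `h = -(nn adjacency) - μ`, and for a chirality texture `σ : (ℤ/L)² → Bool`
(`s_x = ±1`) let `D_σ` be crux 3's `d+id` pairing matrix at zero phase texture with the `d_xy` amplitude on
the diagonal bond `xy` multiplied by `(s_x + s_y)/2`, `Hb(σ) = [[h, D_σ], [D_σᴴ, -h]]`. For every
`μ ∈ (-4,4)`, `Δ₁ ≠ 0`, `Δ₂ ≠ 0` there is `c_w > 0` (here `c_w = m Δ₂²/E_max²`, `m` the uniform BdG gap of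
`BirBdG.lyap_uniform_gap`, `E_max² = (4+|μ|)² + (4|Δ₁|+4|Δ₂|)²`) such that for all `L ≥ 3` and ALL `σ`,
  `c_w · #{ordered diagonal bonds (x,y) : σ x ≠ σ y} ≤ Σ_i |λ_i(Hb(+))| - Σ_i |λ_i(Hb(σ))|`.

PROOF. `BirChirality.chir_core` (file `…ChiralityWallCore`: Lyapunov/BCS-duality deficit bound of crux 3
with the split stencil; the `A`–`B` cross terms vanish) gives `S(+) - S(σ) ≥ (m/4) ‖[F_B, diag s]‖²_HS`,
and `chir_bond` (this file) bounds the commutator from below by the frustrated diagonal bonds: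
`‖[F_B, diag s]‖²_HS ≥ 4 Σ_{frustrated (x,y)} |F_B(x,y)|²`, where on a diagonal bond
`|F_B(±(1,1))|² + |F_B(∓(1,1))|² ≥ ½ (Im(F_B(1,1) + F_B(-1,-1)))² = ½ (8Δ₂ K/N)²`,
`K = Σ_k sin²p₀ sin²p₁/E_k ≥ N/(4E_max)` (the mixed sum `Σ_k sin p₀ cos p₀ sin p₁ cos p₁/E_k` vanishes by
the reflection `p₀ ↦ -p₀`; `Σ_k sin²p₀ sin²p₁ = N/4` exactly for `L ≥ 3`). The constant is of the same
(condensation) scale as crux 3's and is what the sheet-Peierls step of the line consumes at the block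
scale (card §Barriers); numerically the true wall cost is Andreev-scale (kit j015377 Toy B).

References: V. Bach, E. H. Lieb, J. P. Solovej, J. Stat. Phys. 76 (1994) 3 (Bach's inequality,
generalised HF); A. Deuchert, A. Geisinger, C. Hainzl, M. Loss, Ann. Henri Poincaré 19 (2018) 1507;
M. Sigrist, K. Ueda, Rev. Mod. Phys. 63 (1991) 239, §VI; G. E. Volovik, JETP Lett. 66 (1997) 522
(d±id domain walls). No definition is introduced.
-/

noncomputable section

namespace Summit.HubbardSuperconductivity.HubbardSuperconductivity.Theorems

namespace BirChirality

open Matrix Finset Literature.Probability.LatticeModels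
open Summit.HubbardSuperconductivity.HubbardSuperconductivity.Theorems.BirBdG
open scoped ComplexConjugate ComplexOrder

variable {L : ℕ} [NeZero L]

/-! ### The diagonal-bond amplitude of `F_B` and the frustration count -/

/-- **The diagonal-bond pair amplitude bound.** With `f(z) = N⁻¹ Σ_k (B_k/E_k) χ_k(z)` (`F_B(x,y) = f(x-y)`),
`0 < E_k ≤ E_max` and `s_x = ±1` the sign of the chirality texture `σ`:
`(4Δ₂²/E_max²) · #{ordered diagonal bonds with σ x ≠ σ y} ≤ Σ_{x,y} |F_B(x,y)|² |s_y - s_x|²`. [folklore] -/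
theorem chir_bond (μ Δ₁ Δ₂ Emax : ℝ) (hL : 3 ≤ L) (ξ E : TorusSite 2 L → ℝ) (Δ B : TorusSite 2 L → ℂ)
    (hξ : ∀ k, ξ k = -2 * Real.cos (latticeMomentum L k 0) - 2 * Real.cos (latticeMomentum L k 1) - μ)
    (hΔ : ∀ k, Δ k = ((2 * Δ₁ * (Real.cos (latticeMomentum L k 0) - Real.cos (latticeMomentum L k 1)) : ℝ) : ℂ) -
      4 * Complex.I * ((Δ₂ * Real.sin (latticeMomentum L k 0) * Real.sin (latticeMomentum L k 1) : ℝ) : ℂ))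
    (hB : ∀ k, B k = -(4 * Complex.I *
      ((Δ₂ * Real.sin (latticeMomentum L k 0) * Real.sin (latticeMomentum L k 1) : ℝ) : ℂ)))
    (hE : ∀ k, E k = Real.sqrt (ξ k ^ 2 + ‖Δ k‖ ^ 2)) (hEpos : ∀ k, 0 < E k) (hEmax : ∀ k, E k ≤ Emax)
    (σ : TorusSite 2 L → Bool) (s : TorusSite 2 L → ℂ) (hs : ∀ x, s x = if σ x then 1 else -1) :
    4 * Δ₂ ^ 2 / Emax ^ 2 * ((((Finset.univ : Finset (TorusSite 2 L × TorusSite 2 L)).filter fun p =>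
        (p.2 = p.1 + ![1, 1] ∨ p.2 = p.1 + ![-1, -1] ∨ p.2 = p.1 + ![1, -1] ∨ p.2 = p.1 + ![-1, 1]) ∧
          σ p.1 ≠ σ p.2).card : ℕ) : ℝ) ≤
      ∑ x : TorusSite 2 L, ∑ y : TorusSite 2 L,
        ‖(((L ^ 2 : ℕ) : ℂ)⁻¹ • ((Matrix.of fun k x : TorusSite 2 L => conj (torusChar k x))ᴴ *
            Matrix.diagonal (fun k => B k / (E k : ℂ)) *
            Matrix.of (fun k x : TorusSite 2 L => conj (torusChar k x)))) x y‖ ^ 2 * ‖s y - s x‖ ^ 2 := by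
  have hN : ((L ^ 2 : ℕ) : ℝ) ≠ 0 := by exact_mod_cast pow_ne_zero 2 (NeZero.ne L)
  have hNpos : (0 : ℝ) < ((L ^ 2 : ℕ) : ℝ) := by exact_mod_cast pow_pos (Nat.pos_of_ne_zero (NeZero.ne L)) 2
  have hEmaxpos : 0 < Emax := lt_of_lt_of_le (hEpos 0) (hEmax 0)
  -- the `d_xy` anomalous amplitude as a function of the bond vector
  set f : TorusSite 2 L → ℂ := fun z => ((L ^ 2 : ℕ) : ℂ)⁻¹ * ∑ k, B k / (E k : ℂ) * torusChar k z
    with hf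
  have hF : ∀ x y, (((L ^ 2 : ℕ) : ℂ)⁻¹ • ((Matrix.of fun k x : TorusSite 2 L => conj (torusChar k x))ᴴ *
      Matrix.diagonal (fun k => B k / (E k : ℂ)) *
      Matrix.of (fun k x : TorusSite 2 L => conj (torusChar k x)))) x y = f (x - y) := by
    intro x y
    rw [lyap_unhat_diagonal_apply]
  -- the frustration indicator
  set c : TorusSite 2 L → TorusSite 2 L → ℝ := fun x y => if σ x = σ y then 0 else 1 with hc
  have hcnn : ∀ x y, 0 ≤ c x y := fun x y => by
    rw [hc]
    dsimp only
    split_ifs <;> norm_num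
  have hcsymm : ∀ x y, c x y = c y x := fun x y => by
    rw [hc]
    dsimp only
    cases σ x <;> cases σ y <;> simp
  have hsc : ∀ x y, ‖s y - s x‖ ^ 2 = 4 * c x y := fun x y => by
    rw [hs, hs, hc]
    dsimp only
    cases σ x <;> cases σ y <;> norm_num
  -- bond sums along the two diagonal directions
  set R0 : ℝ := ∑ x, c x (x + (Pi.single 0 1 + Pi.single 1 1)) with hR0
  set R1 : ℝ := ∑ x, c x (x + (Pi.single 0 1 - Pi.single 1 1)) with hR1
  have hR0nn : 0 ≤ R0 := Finset.sum_nonneg fun x _ => hcnn _ _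
  have hR1nn : 0 ≤ R1 := Finset.sum_nonneg fun x _ => hcnn _ _
  have hshift : ∀ e : TorusSite 2 L, ∑ x, c x (x + -e) = ∑ x, c x (x + e) := by
    intro e
    rw [← Equiv.sum_comp (Equiv.addRight e)]
    refine Finset.sum_congr rfl fun x _ => ?_
    simp only [Equiv.coe_addRight, add_neg_cancel_right]
    exact hcsymm _ _
  have hR0' : ∑ x, c x (x + -(Pi.single 0 1 + Pi.single 1 1)) = R0 := hshift _
  have hR1' : ∑ x, c x (x + -(Pi.single 0 1 - Pi.single 1 1)) = R1 := hshift _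
  -- the frustration count is `2 R₀ + 2 R₁`
  have hcount : ((((Finset.univ : Finset (TorusSite 2 L × TorusSite 2 L)).filter fun p =>
      (p.2 = p.1 + ![1, 1] ∨ p.2 = p.1 + ![-1, -1] ∨ p.2 = p.1 + ![1, -1] ∨ p.2 = p.1 + ![-1, 1]) ∧
        σ p.1 ≠ σ p.2).card : ℕ) : ℝ) = 2 * R0 + 2 * R1 := by
    rw [Finset.card_filter, Nat.cast_sum, Fintype.sum_prod_type]
    have hxy : ∀ x y : TorusSite 2 L,
        (((if ((y = x + ![1, 1] ∨ y = x + ![-1, -1] ∨ y = x + ![1, -1] ∨ y = x + ![-1, 1]) ∧ σ x ≠ σ y)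
          then 1 else 0 : ℕ) : ℝ)) =
          if (y = x + ![1, 1] ∨ y = x + ![-1, -1] ∨ y = x + ![1, -1] ∨ y = x + ![-1, 1]) then c x y else 0 := by
      intro x y
      rw [hc]
      dsimp only
      by_cases hq : (y = x + ![1, 1] ∨ y = x + ![-1, -1] ∨ y = x + ![1, -1] ∨ y = x + ![-1, 1])
      · rw [if_pos hq]
        by_cases he : σ x = σ y
        · rw [if_pos he, if_neg (fun h => h.2 he), Nat.cast_zero]
        · rw [if_neg he, if_pos ⟨hq, he⟩, Nat.cast_one]
      · rw [if_neg hq, if_neg (fun h => hq h.1), Nat.cast_zero]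
    simp only []
    simp_rw [hxy, sum_ite_diag_eq hL _ (fun y => c _ y)]
    rw [Finset.sum_add_distrib, Finset.sum_add_distrib, Finset.sum_add_distrib]
    change ∑ x, c x (x + (Pi.single 0 1 + Pi.single 1 1)) + ∑ x, c x (x + -(Pi.single 0 1 + Pi.single 1 1)) +
      ∑ x, c x (x + (Pi.single 0 1 - Pi.single 1 1)) + ∑ x, c x (x + -(Pi.single 0 1 - Pi.single 1 1)) =
      2 * R0 + 2 * R1
    rw [hR0', hR1']
    ring
  -- keep the four diagonal-neighbour terms of the right-hand side
  have hrhs : ∑ x : TorusSite 2 L, ∑ y : TorusSite 2 L, ‖f (x - y)‖ ^ 2 * ‖s y - s x‖ ^ 2 ≥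
      4 * ((‖f (-(Pi.single 0 1 + Pi.single 1 1))‖ ^ 2 + ‖f (Pi.single 0 1 + Pi.single 1 1)‖ ^ 2) * R0 +
        (‖f (-(Pi.single 0 1 - Pi.single 1 1))‖ ^ 2 + ‖f (Pi.single 0 1 - Pi.single 1 1)‖ ^ 2) * R1) := by
    have hxy : ∀ x y, ‖f (x - y)‖ ^ 2 * ‖s y - s x‖ ^ 2 = 4 * (‖f (x - y)‖ ^ 2 * c x y) := by
      intro x y
      rw [hsc]
      ring
    simp_rw [hxy]
    have hlow : ∀ x : TorusSite 2 L,
        ∑ y, (if (y = x + ![1, 1] ∨ y = x + ![-1, -1] ∨ y = x + ![1, -1] ∨ y = x + ![-1, 1])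
          then 4 * (‖f (x - y)‖ ^ 2 * c x y) else 0) ≤ ∑ y, 4 * (‖f (x - y)‖ ^ 2 * c x y) := by
      intro x
      refine Finset.sum_le_sum fun y _ => ?_
      split_ifs
      · exact le_rfl
      · exact mul_nonneg (by norm_num) (mul_nonneg (sq_nonneg _) (hcnn x y))
    have hsum := Finset.sum_le_sum fun x (_ : x ∈ Finset.univ) => hlow x
    refine le_trans (le_of_eq ?_) hsum
    simp_rw [sum_ite_diag_eq hL _ (fun y => 4 * (‖f (_ - y)‖ ^ 2 * c _ y))]
    rw [Finset.sum_add_distrib, Finset.sum_add_distrib, Finset.sum_add_distrib]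
    have hsub : ∀ (x e : TorusSite 2 L), x - (x + e) = -e := fun x e => by abel
    simp only [hsub, neg_neg]
    have e1 : ∑ x, 4 * (‖f (-(Pi.single 0 1 + Pi.single 1 1))‖ ^ 2 * c x (x + (Pi.single 0 1 + Pi.single 1 1))) =
        4 * ‖f (-(Pi.single 0 1 + Pi.single 1 1))‖ ^ 2 * R0 := by
      rw [hR0, Finset.mul_sum]; exact Finset.sum_congr rfl fun x _ => by ring
    have e2 : ∑ x, 4 * (‖f (Pi.single 0 1 + Pi.single 1 1)‖ ^ 2 * c x (x + -(Pi.single 0 1 + Pi.single 1 1))) =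
        4 * ‖f (Pi.single 0 1 + Pi.single 1 1)‖ ^ 2 * R0 := by
      rw [← hR0', Finset.mul_sum]; exact Finset.sum_congr rfl fun x _ => by ring
    have e3 : ∑ x, 4 * (‖f (-(Pi.single 0 1 - Pi.single 1 1))‖ ^ 2 * c x (x + (Pi.single 0 1 - Pi.single 1 1))) =
        4 * ‖f (-(Pi.single 0 1 - Pi.single 1 1))‖ ^ 2 * R1 := by
      rw [hR1, Finset.mul_sum]; exact Finset.sum_congr rfl fun x _ => by ring
    have e4 : ∑ x, 4 * (‖f (Pi.single 0 1 - Pi.single 1 1)‖ ^ 2 * c x (x + -(Pi.single 0 1 - Pi.single 1 1))) =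
        4 * ‖f (Pi.single 0 1 - Pi.single 1 1)‖ ^ 2 * R1 := by
      rw [← hR1', Finset.mul_sum]; exact Finset.sum_congr rfl fun x _ => by ring
    rw [e1, e2, e3, e4]
    ring
  -- the symmetric sums `f(v) + f(-v)` on the two diagonal vectors and their imaginary parts
  have hpair0 : f (Pi.single 0 1 + Pi.single 1 1) + f (-(Pi.single 0 1 + Pi.single 1 1)) =
      ((L ^ 2 : ℕ) : ℂ)⁻¹ * ∑ k, B k / (E k : ℂ) *
        ((2 * Real.cos (latticeMomentum L k 0 + latticeMomentum L k 1) : ℝ) : ℂ) := by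
    rw [hf]
    dsimp only
    rw [← mul_add, ← Finset.sum_add_distrib]
    congr 1
    refine Finset.sum_congr rfl fun k _ => ?_
    rw [← mul_add, torusChar_neg_right, torusChar_diag_add_conj]
  have hpair1 : f (Pi.single 0 1 - Pi.single 1 1) + f (-(Pi.single 0 1 - Pi.single 1 1)) =
      ((L ^ 2 : ℕ) : ℂ)⁻¹ * ∑ k, B k / (E k : ℂ) *
        ((2 * Real.cos (latticeMomentum L k 0 - latticeMomentum L k 1) : ℝ) : ℂ) := by
    rw [hf]
    dsimp only
    rw [← mul_add, ← Finset.sum_add_distrib]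
    congr 1
    refine Finset.sum_congr rfl fun k _ => ?_
    rw [← mul_add, torusChar_neg_right, torusChar_antidiag_add_conj]
  -- the two lattice sums `J` (odd under `p₀ ↦ -p₀`, hence zero) and `K ≥ N/(4 E_max)`
  set J : ℝ := ∑ k : TorusSite 2 L, Real.sin (latticeMomentum L k 0) * Real.cos (latticeMomentum L k 0) *
    (Real.sin (latticeMomentum L k 1) * Real.cos (latticeMomentum L k 1)) / E k with hJ
  set K : ℝ := ∑ k : TorusSite 2 L, Real.sin (latticeMomentum L k 0) ^ 2 *
    Real.sin (latticeMomentum L k 1) ^ 2 / E k with hK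
  have him0 : (f (Pi.single 0 1 + Pi.single 1 1) + f (-(Pi.single 0 1 + Pi.single 1 1))).im =
      ((L ^ 2 : ℕ) : ℝ)⁻¹ * (-8 * Δ₂ * (J - K)) := by
    rw [hpair0, show (((L ^ 2 : ℕ) : ℂ))⁻¹ = ((((L ^ 2 : ℕ) : ℝ)⁻¹ : ℝ) : ℂ) by push_cast; rfl,
      Complex.im_ofReal_mul, Complex.im_sum]
    congr 1
    rw [hJ, hK, ← Finset.sum_sub_distrib, Finset.mul_sum]
    refine Finset.sum_congr rfl fun k _ => ?_
    rw [hB, im_dxy_mode, Real.cos_add]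
    have hk := (hEpos k).ne'
    field_simp
  have him1 : (f (Pi.single 0 1 - Pi.single 1 1) + f (-(Pi.single 0 1 - Pi.single 1 1))).im =
      ((L ^ 2 : ℕ) : ℝ)⁻¹ * (-8 * Δ₂ * (J + K)) := by
    rw [hpair1, show (((L ^ 2 : ℕ) : ℂ))⁻¹ = ((((L ^ 2 : ℕ) : ℝ)⁻¹ : ℝ) : ℂ) by push_cast; rfl,
      Complex.im_ofReal_mul, Complex.im_sum]
    congr 1
    rw [hJ, hK, ← Finset.sum_add_distrib, Finset.mul_sum]
    refine Finset.sum_congr rfl fun k _ => ?_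
    rw [hB, im_dxy_mode, Real.cos_sub]
    have hk := (hEpos k).ne'
    field_simp
  -- `J = 0` by the reflection `p₀ ↦ -p₀` (under which `E` is invariant)
  have hER : ∀ k : TorusSite 2 L, E (Function.update k 0 (-(k 0))) = E k := by
    intro k
    obtain ⟨hc0, hs0, h1⟩ := trig_reflect0 (L := L) k
    rw [hE, hE, hξ, hξ, hΔ, hΔ, hc0, hs0, h1]
    have hconj : ((2 * Δ₁ * (Real.cos (latticeMomentum L k 0) - Real.cos (latticeMomentum L k 1)) : ℝ) : ℂ) -
        4 * Complex.I * ((Δ₂ * -Real.sin (latticeMomentum L k 0) * Real.sin (latticeMomentum L k 1) : ℝ) : ℂ) =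
        conj (((2 * Δ₁ * (Real.cos (latticeMomentum L k 0) - Real.cos (latticeMomentum L k 1)) : ℝ) : ℂ) -
          4 * Complex.I * ((Δ₂ * Real.sin (latticeMomentum L k 0) * Real.sin (latticeMomentum L k 1) : ℝ) : ℂ)) := by
      simp only [map_sub, map_mul, Complex.conj_ofReal, Complex.conj_I, Complex.conj_ofNat]
      push_cast
      ring
    rw [hconj, Complex.norm_conj]
  have hJ0 : J = 0 := by
    have hodd : ∀ k : TorusSite 2 L,
        Real.sin (latticeMomentum L (Function.update k 0 (-(k 0))) 0) *
            Real.cos (latticeMomentum L (Function.update k 0 (-(k 0))) 0) *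
          (Real.sin (latticeMomentum L (Function.update k 0 (-(k 0))) 1) *
            Real.cos (latticeMomentum L (Function.update k 0 (-(k 0))) 1)) / E (Function.update k 0 (-(k 0))) =
        -(Real.sin (latticeMomentum L k 0) * Real.cos (latticeMomentum L k 0) *
          (Real.sin (latticeMomentum L k 1) * Real.cos (latticeMomentum L k 1)) / E k) := by
      intro k
      obtain ⟨hc0, hs0, h1⟩ := trig_reflect0 (L := L) k
      rw [hc0, hs0, h1, hER]
      ring
    have hreindex := Equiv.sum_comp (Function.Involutive.toPerm _ (reflect0_involutive (L := L)))
      (fun k : TorusSite 2 L => Real.sin (latticeMomentum L k 0) * Real.cos (latticeMomentum L k 0) *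
        (Real.sin (latticeMomentum L k 1) * Real.cos (latticeMomentum L k 1)) / E k)
    simp only [Function.Involutive.coe_toPerm] at hreindex
    have hneg : J = -J := by
      rw [hJ]
      conv_lhs => rw [← hreindex]
      rw [← Finset.sum_neg_distrib]
      exact Finset.sum_congr rfl fun k _ => hodd k
    linarith
  have hKlow : ((L ^ 2 : ℕ) : ℝ) / 4 / Emax ≤ K := by
    rw [hK, ← sum_sin_sq_mul_sin_sq hL, Finset.sum_div]
    refine Finset.sum_le_sum fun k _ => ?_
    exact div_le_div_of_nonneg_left (by positivity) (hEpos k) (hEmax k)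
  have hKsq : (((L ^ 2 : ℕ) : ℝ) / 4 / Emax) ^ 2 ≤ K ^ 2 := pow_le_pow_left₀ (by positivity) hKlow 2
  -- the squared imaginary parts dominate `4 Δ₂²/E_max²`
  have hsq : ∀ t : ℝ, t = ((L ^ 2 : ℕ) : ℝ)⁻¹ * (-8 * Δ₂ * (J - K)) ∨ t = ((L ^ 2 : ℕ) : ℝ)⁻¹ * (-8 * Δ₂ * (J + K)) →
      4 * Δ₂ ^ 2 / Emax ^ 2 ≤ t ^ 2 := by
    intro t ht
    have ht2 : t ^ 2 = 64 * Δ₂ ^ 2 * K ^ 2 / ((L ^ 2 : ℕ) : ℝ) ^ 2 := by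
      rcases ht with h | h <;> rw [h, hJ0] <;> field_simp <;> ring
    have e2 : 4 * Δ₂ ^ 2 / Emax ^ 2 = 64 * Δ₂ ^ 2 * (((L ^ 2 : ℕ) : ℝ) / 4 / Emax) ^ 2 / ((L ^ 2 : ℕ) : ℝ) ^ 2 := by
      field_simp
      ring
    rw [ht2, e2]
    exact div_le_div_of_nonneg_right (mul_le_mul_of_nonneg_left hKsq (by positivity)) (by positivity)
  have him0sq := hsq _ (Or.inl him0)
  have him1sq := hsq _ (Or.inr him1)
  have hp0 := normSq_add_normSq_ge_im (f (Pi.single 0 1 + Pi.single 1 1)) (f (-(Pi.single 0 1 + Pi.single 1 1)))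
  have hp1 := normSq_add_normSq_ge_im (f (Pi.single 0 1 - Pi.single 1 1)) (f (-(Pi.single 0 1 - Pi.single 1 1)))
  have k0 : 2 * (4 * Δ₂ ^ 2 / Emax ^ 2) ≤
      4 * (‖f (-(Pi.single 0 1 + Pi.single 1 1))‖ ^ 2 + ‖f (Pi.single 0 1 + Pi.single 1 1)‖ ^ 2) := by
    linarith
  have k1 : 2 * (4 * Δ₂ ^ 2 / Emax ^ 2) ≤
      4 * (‖f (-(Pi.single 0 1 - Pi.single 1 1))‖ ^ 2 + ‖f (Pi.single 0 1 - Pi.single 1 1)‖ ^ 2) := by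
    linarith
  -- assemble
  simp_rw [hF]
  rw [hcount]
  refine le_trans ?_ hrhs
  calc 4 * Δ₂ ^ 2 / Emax ^ 2 * (2 * R0 + 2 * R1)
      = 2 * (4 * Δ₂ ^ 2 / Emax ^ 2) * R0 + 2 * (4 * Δ₂ ^ 2 / Emax ^ 2) * R1 := by ring
    _ ≤ 4 * (‖f (-(Pi.single 0 1 + Pi.single 1 1))‖ ^ 2 + ‖f (Pi.single 0 1 + Pi.single 1 1)‖ ^ 2) * R0 +
        4 * (‖f (-(Pi.single 0 1 - Pi.single 1 1))‖ ^ 2 + ‖f (Pi.single 0 1 - Pi.single 1 1)‖ ^ 2) * R1 := by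
        gcongr
    _ = 4 * ((‖f (-(Pi.single 0 1 + Pi.single 1 1))‖ ^ 2 + ‖f (Pi.single 0 1 + Pi.single 1 1)‖ ^ 2) * R0 +
        (‖f (-(Pi.single 0 1 - Pi.single 1 1))‖ ^ 2 + ‖f (Pi.single 0 1 - Pi.single 1 1)‖ ^ 2) * R1) := by ring

end BirChirality

/-! ### The static input (W) of the line `chirality-sheet-peierls` -/

open Matrix Finset Literature.Probability.LatticeModels BirBdG BirChirality
open scoped ComplexConjugate ComplexOrder

/-- **Chirality-wall coercivity of the `d+id` Bogoliubov–de Gennes energy** (route BalabanIR, crux 4R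
`BirGappedPhaseReductionR`, line `chirality-sheet-peierls`, static input (W); the body of the card's
`BdGChiralityWallCoercivity` with `bdgHb`, `frustratedDiagonals` unfolded). See the module docstring for
the constant and the proof. [cite: BachLiebSolovej1994, Theorem 2.11] -/
theorem bdgChiralityWallCoercivity : ∀ (μ Δ₁ Δ₂ : ℝ), μ ∈ Set.Ioo (-4:ℝ) 4 → Δ₁ ≠ 0 → Δ₂ ≠ 0 → ∃ c_w : ℝ, 0 < c_w ∧ ∃ L₀ : ℕ, ∀ (L : ℕ) [NeZero L], L₀ ≤ L → ∀ σ : Literature.Probability.LatticeModels.TorusSite 2 L → Bool, let nnx : Literature.Probability.LatticeModels.TorusSite 2 L → Literature.Probability.LatticeModels.TorusSite 2 L → Prop := fun x y => y = x + ![1, 0] ∨ y = x + ![-1, 0]; let nny : Literature.Probability.LatticeModels.TorusSite 2 L → Literature.Probability.LatticeModels.TorusSite 2 L → Prop := fun x y => y = x + ![0, 1] ∨ y = x + ![0, -1]; let dg1 : Literature.Probability.LatticeModels.TorusSite 2 L → Literature.Probability.LatticeModels.TorusSite 2 L → Prop := fun x y => y = x + ![1, 1] ∨ y = x + ![-1,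 -1]; let dg2 : Literature.Probability.LatticeModels.TorusSite 2 L → Literature.Probability.LatticeModels.TorusSite 2 L → Prop := fun x y => y = x + ![1, -1] ∨ y = x + ![-1, 1]; let h : Matrix (Literature.Probability.LatticeModels.TorusSite 2 L) (Literature.Probability.LatticeModels.TorusSite 2 L) ℂ := fun x y => -(if nnx x y ∨ nny x y then (1 : ℂ) else 0) - (if x = y then (μ : ℂ) else 0); let D : (Literature.Probability.LatticeModels.TorusSite 2 L → Bool) → Matrix (Literature.Probability.LatticeModels.TorusSite 2 L) (Literature.Probability.LatticeModels.TorusSite 2 L) ℂ := fun τ x y => ((Δ₁ : ℂ) * ((if nnx x y then (1 : ℂ) else 0) - (if nny x y then (1 : ℂ) else 0)) + Complex.I * (Δ₂ : ℂ) * ((if dg1 x y then (1 : ℂ) else 0) - (if dg2 x y then (1 : ℂ) else 0)) * (((if τ x then (1 : ℂ) else -1) + (if τ y then (1 : ℂ) else -1)) / 2)) * (Complex.exp (Complex.I * ((0 : ℝ) : ℂ)) + Complex.exp (Complex.I * ((0 : ℝ) : ℂ))) / 2; let Hb : (Literature.Probability.LatticeModels.TorusSite 2 L → Bool) → Matrix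 (Literature.Probability.LatticeModels.TorusSite 2 L ⊕ Literature.Probability.LatticeModels.TorusSite 2 L) (Literature.Probability.LatticeModels.TorusSite 2 L ⊕ Literature.Probability.LatticeModels.TorusSite 2 L) ℂ := fun τ => Matrix.fromBlocks h (D τ) (Matrix.conjTranspose (D τ)) (-h); ∀ (hσ : (Hb σ).IsHermitian) (h0 : (Hb (fun _ => true)).IsHermitian), c_w * ((((Finset.univ : Finset (Literature.Probability.LatticeModels.TorusSite 2 L × Literature.Probability.LatticeModels.TorusSite 2 L)).filter fun p => (p.2 = p.1 + ![1, 1] ∨ p.2 = p.1 + ![-1, -1] ∨ p.2 = p.1 + ![1, -1] ∨ p.2 = p.1 + ![-1, 1]) ∧ σ p.1 ≠ σ p.2).card : ℕ) : ℝ) ≤ ∑ i, |h0.eigenvalues i| - ∑ i, |hσ.eigenvalues i| := by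
  intro μ Δ₁ Δ₂ hμ h₁ h₂
  obtain ⟨m, hm, hmle⟩ := lyap_uniform_gap μ Δ₁ Δ₂ hμ h₁ h₂
  set Emax : ℝ := Real.sqrt ((4 + |μ|) ^ 2 + (4 * |Δ₁| + 4 * |Δ₂|) ^ 2) with hEmax
  have hEmaxpos : 0 < Emax := by
    rw [hEmax]
    exact Real.sqrt_pos.2 (by positivity)
  have hΔ₂sq : 0 < Δ₂ ^ 2 := by positivity
  refine ⟨m / 4 * (4 * Δ₂ ^ 2 / Emax ^ 2), by positivity, 3, ?_⟩
  intro L _ hL σ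
  -- the symbols at side `L`
  set ξ : TorusSite 2 L → ℝ := fun k =>
    -2 * Real.cos (latticeMomentum L k 0) - 2 * Real.cos (latticeMomentum L k 1) - μ with hξ
  set Δ : TorusSite 2 L → ℂ := fun k =>
    ((2 * Δ₁ * (Real.cos (latticeMomentum L k 0) - Real.cos (latticeMomentum L k 1)) : ℝ) : ℂ) -
      4 * Complex.I * ((Δ₂ * Real.sin (latticeMomentum L k 0) * Real.sin (latticeMomentum L k 1) : ℝ) : ℂ)
    with hΔ
  set A : TorusSite 2 L → ℂ := fun k =>
    ((2 * Δ₁ * (Real.cos (latticeMomentum L k 0) - Real.cos (latticeMomentum L k 1)) : ℝ) : ℂ) with hA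
  set B : TorusSite 2 L → ℂ := fun k =>
    -(4 * Complex.I * ((Δ₂ * Real.sin (latticeMomentum L k 0) * Real.sin (latticeMomentum L k 1) : ℝ) : ℂ))
    with hB
  set E : TorusSite 2 L → ℝ := fun k => Real.sqrt (ξ k ^ 2 + ‖Δ k‖ ^ 2) with hE
  have hmE : ∀ k, m ≤ E k := fun k =>
    hmle _ _ (lyap_latticeMomentum_mem k 0) (lyap_latticeMomentum_mem k 1)
  have hEpos : ∀ k, 0 < E k := fun k => lt_of_lt_of_le hm (hmE k)
  have hEmaxle : ∀ k, E k ≤ Emax := fun k =>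
    Real.sqrt_le_sqrt (lyap_norm_sq_gap_le μ Δ₁ Δ₂ _ _)
  intro nnx nny dg1 dg2 h D Hb hσ h0
  -- the sign texture
  set s : TorusSite 2 L → ℂ := fun x => if σ x then (1 : ℂ) else -1 with hs
  have hs' : ∀ x, s x = 1 ∨ s x = -1 := fun x => by
    rw [hs]
    dsimp only
    cases σ x <;> simp
  -- structural identities
  have hh : h = Matrix.circulant (fun r : TorusSite 2 L =>
      -(if ((r = -![1, 0] ∨ r = -![-1, 0]) ∨ (r = -![0, 1] ∨ r = -![0, -1])) then (1 : ℂ) else 0) -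
        (if r = 0 then (μ : ℂ) else 0)) := hopping_eq_circulant μ
  have hC : D (fun _ => true) = Matrix.circulant (fun r : TorusSite 2 L =>
      (Δ₁ : ℂ) * ((if (r = -![1, 0] ∨ r = -![-1, 0]) then (1 : ℂ) else 0) -
          (if (r = -![0, 1] ∨ r = -![0, -1]) then (1 : ℂ) else 0)) +
        Complex.I * (Δ₂ : ℂ) * ((if (r = -![1, 1] ∨ r = -![-1, -1]) then (1 : ℂ) else 0) -
          (if (r = -![1, -1] ∨ r = -![-1, 1]) then (1 : ℂ) else 0))) := chirality_pairing_true_eq Δ₁ Δ₂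
  have hD : D σ = Matrix.circulant (fun r : TorusSite 2 L =>
      (Δ₁ : ℂ) * ((if (r = -![1, 0] ∨ r = -![-1, 0]) then (1 : ℂ) else 0) -
          (if (r = -![0, 1] ∨ r = -![0, -1]) then (1 : ℂ) else 0))) +
      (1 / 2 : ℂ) • (Matrix.diagonal s * Matrix.circulant (fun r : TorusSite 2 L =>
          Complex.I * (Δ₂ : ℂ) * ((if (r = -![1, 1] ∨ r = -![-1, -1]) then (1 : ℂ) else 0) -
            (if (r = -![1, -1] ∨ r = -![-1, 1]) then (1 : ℂ) else 0))) +
        Matrix.circulant (fun r : TorusSite 2 L =>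
          Complex.I * (Δ₂ : ℂ) * ((if (r = -![1, 1] ∨ r = -![-1, -1]) then (1 : ℂ) else 0) -
            (if (r = -![1, -1] ∨ r = -![-1, 1]) then (1 : ℂ) else 0))) * Matrix.diagonal s) :=
    chirality_pairing_eq Δ₁ Δ₂ σ
  have core := chir_core μ Δ₁ Δ₂ m hL ξ E Δ A B (fun _ => rfl) (fun _ => rfl) (fun _ => rfl) (fun _ => rfl)
    (fun _ => rfl) hm hmE s hs' h (D (fun _ => true)) (D σ) hh hC hD h0 hσ
  have hb := chir_bond μ Δ₁ Δ₂ Emax hL ξ E Δ B (fun _ => rfl) (fun _ => rfl) (fun _ => rfl) (fun _ => rfl)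
    hEpos hEmaxle σ s (fun _ => rfl)
  calc m / 4 * (4 * Δ₂ ^ 2 / Emax ^ 2) * ((((Finset.univ : Finset (TorusSite 2 L × TorusSite 2 L)).filter
        fun p => (p.2 = p.1 + ![1, 1] ∨ p.2 = p.1 + ![-1, -1] ∨ p.2 = p.1 + ![1, -1] ∨ p.2 = p.1 + ![-1, 1]) ∧
          σ p.1 ≠ σ p.2).card : ℕ) : ℝ)
      = m / 4 * (4 * Δ₂ ^ 2 / Emax ^ 2 * ((((Finset.univ : Finset (TorusSite 2 L × TorusSite 2 L)).filter
        fun p => (p.2 = p.1 + ![1, 1] ∨ p.2 = p.1 + ![-1, -1] ∨ p.2 = p.1 + ![1, -1] ∨ p.2 = p.1 + ![-1, 1]) ∧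
          σ p.1 ≠ σ p.2).card : ℕ) : ℝ)) := by ring
    _ ≤ m / 4 * ∑ x : TorusSite 2 L, ∑ y : TorusSite 2 L,
        ‖(((L ^ 2 : ℕ) : ℂ)⁻¹ • ((Matrix.of fun k x : TorusSite 2 L => conj (torusChar k x))ᴴ *
            Matrix.diagonal (fun k => B k / (E k : ℂ)) *
            Matrix.of (fun k x : TorusSite 2 L => conj (torusChar k x)))) x y‖ ^ 2 * ‖s y - s x‖ ^ 2 :=
        mul_le_mul_of_nonneg_left hb (by positivity)
    _ ≤ ∑ i, |h0.eigenvalues i| - ∑ i, |hσ.eigenvalues i| := core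

end Summit.HubbardSuperconductivity.HubbardSuperconductivity.Theorems

end
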